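import Summits.AtomisticToContinuum.Crystallization.Theses.HolmgrenBoyleLind
import Summits.AtomisticToContinuum.Crystallization.Theorems.HolmgrenBoyleLindPatchHull

/-!
# Route `HolmgrenBoyleLind`, crux `GroundStatesChargeFLCEquilibrium`: `O(R⁻⁴)` ball partial sums
# of the absolutely summable force series force `HasSum … 0`

Support file for item stmt-AtomisticToContinuum-6076 (crux
`HolmgrenBoyleLind.GroundStatesChargeFLCEquilibrium`), stub `stub_hasSumZeroOfPartialSums` of the
registered line. Let `Λ ⊂ ℝ³` be `δ'`-separated and `q ∈ Λ`. If for some `C'` and every `R ≥ 2`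
the Lennard-Jones force on `q` exerted by the points `s ∈ Λ ∖ {q}` with `dist s q < R` has norm
`≤ C'/R⁴`, then the full force series `Σ_{y ∈ Λ, y ≠ q} (V′(|q − y|)/|q − y|) (q − y)` `HasSum`s to
`0`.

Proof: the series is absolutely summable (`hbl_summable_norm_ljForce`); let `L` be its `tsum`.
For `R ≥ max δ' 2` the finset `T_R` of points of `Λ ∖ {q}` at distance `< R` from `q`
(`hbl_finite_near`, filtered) satisfies the membership clause of the hypothesis, and
`‖L − Σ_{T_R}‖ ≤ 2048/(δ'³R⁴)` (`hbl_norm_tsum_sub_sum_le`), so `‖L‖ ≤ (2048/δ'³ + C')/R⁴ → 0`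
as `R → ∞`; hence `L = 0` and `Summable.hasSum_iff` closes the goal.

All `[folklore]`; nothing here closes an item.
-/

noncomputable section

namespace Summit.AtomisticToContinuum.Crystallization.Theorems.HolmgrenBoyleLindGroundStatesChargeFLCEquilibrium

open Filter
open scoped Topology
open Literature.MathematicalPhysics.StatisticalMechanics

/-- **Norm bound at one radius.** Over a `δ'`-separated `Λ ∋ q`, if the force of the points of
`Λ ∖ {q}` at distance `< R` from `q` (any finset with the stated membership) has norm `≤ C'/R⁴` at a
radius `R ≥ max δ' 1`, then the total force `L = ∑' …` has norm `≤ (2048/δ'³ + C')/R⁴`: triangle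
inequality with the far-field tail `hbl_norm_tsum_sub_sum_le` at the finset of near points
(`hbl_finite_near`). [folklore] -/
theorem hasSumZero_norm_tsum_le {Λ : Set (EuclideanSpace ℝ (Fin 3))} {δ' : ℝ} (hδ' : 0 < δ')
    (hsep : ∀ x ∈ Λ, ∀ y ∈ Λ, x ≠ y → δ' ≤ dist x y) {q : EuclideanSpace ℝ (Fin 3)} (hq : q ∈ Λ)
    {C' R : ℝ} (hδR : δ' ≤ R) (hR : 1 ≤ R)
    (hC' : ∀ T : Finset (EuclideanSpace ℝ (Fin 3)),
      (∀ s : EuclideanSpace ℝ (Fin 3), s ∈ T ↔ s ∈ Λ ∧ s ≠ q ∧ dist s q < R) →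
      ‖∑ s ∈ T, (deriv lennardJones (dist q s) / dist q s) • (q - s)‖ ≤ C' / R ^ 4) :
    ‖∑' y : {y : EuclideanSpace ℝ (Fin 3) // y ∈ Λ ∧ y ≠ q},
        (deriv lennardJones (dist q (y : EuclideanSpace ℝ (Fin 3))) /
          dist q (y : EuclideanSpace ℝ (Fin 3))) • (q - (y : EuclideanSpace ℝ (Fin 3)))‖ ≤
      (2048 / δ' ^ 3 + C') / R ^ 4 := by
  classical
  set T : Finset (EuclideanSpace ℝ (Fin 3)) :=
    (hbl_finite_near hδ' hsep q R).toFinset.filter (fun s => s ≠ q ∧ dist s q < R) with hT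
  have hmem : ∀ s : EuclideanSpace ℝ (Fin 3), s ∈ T ↔ s ∈ Λ ∧ s ≠ q ∧ dist s q < R := by
    intro s
    rw [hT, Finset.mem_filter, Set.Finite.mem_toFinset, Set.mem_setOf_eq]
    exact ⟨fun h => ⟨h.1.1, h.2.1, h.2.2⟩, fun h => ⟨⟨h.1, h.2.2.le⟩, h.2.1, h.2.2⟩⟩
  have htail := hbl_norm_tsum_sub_sum_le hδ' hδR hR hsep hq T hmem
  have hnear := hC' T hmem
  calc ‖∑' y : {y : EuclideanSpace ℝ (Fin 3) // y ∈ Λ ∧ y ≠ q},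
          (deriv lennardJones (dist q (y : EuclideanSpace ℝ (Fin 3))) /
            dist q (y : EuclideanSpace ℝ (Fin 3))) • (q - (y : EuclideanSpace ℝ (Fin 3)))‖
        ≤ ‖∑ s ∈ T, (deriv lennardJones (dist q s) / dist q s) • (q - s)‖ +
          ‖(∑' y : {y : EuclideanSpace ℝ (Fin 3) // y ∈ Λ ∧ y ≠ q},
              (deriv lennardJones (dist q (y : EuclideanSpace ℝ (Fin 3))) /
                dist q (y : EuclideanSpace ℝ (Fin 3))) • (q - (y : EuclideanSpace ℝ (Fin 3)))) -
            ∑ s ∈ T, (deriv lennardJones (dist q s) / dist q s) • (q - s)‖ :=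
          norm_le_norm_add_norm_sub' _ _
    _ ≤ C' / R ^ 4 + 2048 / (δ' ^ 3 * R ^ 4) := add_le_add hnear htail
    _ = (2048 / δ' ^ 3 + C') / R ^ 4 := by rw [add_div, div_div, add_comm]

/-- **Stub 3c — an absolutely summable force series with `O(R⁻⁴)` ball partial sums vanishes.** Let
`Λ` be `δ'`-separated and `q ∈ Λ`. If for some `C'` and every `R ≥ 2` the force on `q` from the
points `s ∈ Λ ∖ {q}` with `dist s q < R` has norm `≤ C'/R⁴`, then the full force series at `q`
`HasSum`s to `0`: the series is absolutely summable (`hbl_summable_norm_ljForce`), its sum `L` has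
norm `≤ (2048/δ'³ + C')/R⁴` for every `R ≥ max δ' 2` (`hasSumZero_norm_tsum_le`), hence `‖L‖ ≤ 0`
by letting `R → ∞`, `L = 0`, and `Summable.hasSum_iff`. [folklore] -/
theorem stub_hasSumZeroOfPartialSums :
    ∀ (Λ : Set (EuclideanSpace ℝ (Fin 3))) (δ' : ℝ), 0 < δ' →
      (∀ x ∈ Λ, ∀ y ∈ Λ, x ≠ y → δ' ≤ dist x y) → ∀ q ∈ Λ,
      (∃ C' : ℝ, ∀ R : ℝ, 2 ≤ R → ∀ T : Finset (EuclideanSpace ℝ (Fin 3)),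
        (∀ s : EuclideanSpace ℝ (Fin 3), s ∈ T ↔ s ∈ Λ ∧ s ≠ q ∧ dist s q < R) →
        ‖∑ s ∈ T, (deriv lennardJones (dist q s) / dist q s) • (q - s)‖ ≤ C' / R ^ 4) →
      HasSum (fun y : {y : EuclideanSpace ℝ (Fin 3) // y ∈ Λ ∧ y ≠ q} =>
        (deriv lennardJones (dist q (y : EuclideanSpace ℝ (Fin 3))) /
          dist q (y : EuclideanSpace ℝ (Fin 3))) • (q - (y : EuclideanSpace ℝ (Fin 3)))) 0 := by
  intro Λ δ' hδ' hsep q hq hC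
  obtain ⟨C', hC'⟩ := hC
  have hsum : Summable (fun y : {y : EuclideanSpace ℝ (Fin 3) // y ∈ Λ ∧ y ≠ q} =>
      (deriv lennardJones (dist q (y : EuclideanSpace ℝ (Fin 3))) /
        dist q (y : EuclideanSpace ℝ (Fin 3))) • (q - (y : EuclideanSpace ℝ (Fin 3)))) :=
    (hbl_summable_norm_ljForce hδ' hsep hq).of_norm
  have hlim : Tendsto (fun R : ℝ => (2048 / δ' ^ 3 + C') / R ^ 4) atTop (𝓝 0) :=
    tendsto_const_nhds.div_atTop (tendsto_pow_atTop (by norm_num))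
  refine hsum.hasSum_iff.2 (norm_le_zero_iff.1 (ge_of_tendsto hlim ?_))
  filter_upwards [eventually_ge_atTop (max δ' 2)] with R hR
  have hδR : δ' ≤ R := (le_max_left _ _).trans hR
  have h2R : (2 : ℝ) ≤ R := (le_max_right _ _).trans hR
  exact hasSumZero_norm_tsum_le hδ' hsep hq hδR (one_le_two.trans h2R) (hC' R h2R)

end Summit.AtomisticToContinuum.Crystallization.Theorems.HolmgrenBoyleLindGroundStatesChargeFLCEquilibrium

end
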